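import Mathlib
import HarnessLib
import Summits.HubbardSuperconductivity.HubbardSuperconductivity.Theorems.KLProgrammeKLRegimeSectorOverlapDefectRows
import Summits.HubbardSuperconductivity.HubbardSuperconductivity.Theorems.KLProgrammeH10TwoPointLimitSectorMultiplierFat

/-!
# Route `KLProgramme` — VL child `KLRegimeVolumeLimitV17F2` (stmt-HubbardSuperconductivity-20440), closer MODEL file M2 «MISMATCH-SLICE», bracket (c),
# part 3: the `δ` of `TwoVolumeDefect.sum_pinned_norm_kernel_map_sub_map_le` for the re-sectorisation defect
# `E(F_{n₁}[K′])·S(F̃_{n₂}[K′]) − E(F_{n₁}[K])·S(F̃_{n₂}[K])` (thin family of scale `n₁`, FAT family of scale `n₂`, `n₂ + 1 ≤ n₁`, two frames, one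
# volume) — FULL row and column sums from ONE uniform bound `T` on the `ℓ¹` size of the thin-pair-difference character sums

Cell `gate-hubbard-kl`, seat hubbard-kl-k3c4-p2 (g11; UV / Matsubara all-U lane), ask «MISMATCH-SLICE» (= M2, bracket (c)) of the VL registrant
k3c4-p1 g11 (KL STATUS 2026-08-27 22:29Z: `δ` = plain column sums + pin row of the difference of the composite re-sectorisations `T_j[K]`, `T_j[K″]`
on the fine volume).  Composition of part 1 (`…SectorOverlapDefectRows`: the defect's position sums are `(βL²)⁻¹ Σ_z ‖S^Δ(z)‖`; the overlap-count
reduction for the joint adjacency) with p4's thin × fat algebra (`klAnisoFamily_mul_bgmFatMultiplier_eq_sum`: the fat multiplier is the sum of the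
`≤ 3` neighbouring thin ones — the SAME index set at both frames; `sum_norm_charSum_sum_le`; the adjacency counts `27` / `27·2^{n₁−n₂}` at each
frame):

* §1 **`charSum_klAniso_bgmFat_sub_le`** — the thin × fat difference character sum is `≤ 3T` if every thin × thin difference character sum of the
  scales `(n₁, n₂)` at the two frames is `≤ T` (the `T` of part 2e-ii, `…SectorMultiplierFrameDiffsL1.sum_norm_charSum_thinPairDiff_le`, linear in `ε`);
* §2 **`rowSum_overlapDefect_le`**, **`colSum_overlapDefect_le`** — per sector pair, the position row / column sums of the defect are `≤ 3T/(βL²)`;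
* §3 **`fullRowSum_overlapDefect_le`** (`≤ 54·3T/(βL²)`), **`fullColSum_overlapDefect_le`** (`≤ 54·2^{n₁−n₂}·3T/(βL²)`) — the sums over ALL
  labels, i.e. the pin-row and column-sum inputs `δ` of `sum_pinned_norm_kernel_map_sub_map_le` (joint adjacency `≤ 27 + 27` by `card_jointOverlap_le`).

Everything is proved; no definitions, no named facts; generic in `T`. [folklore]
References: BGM 2006 §2.7 (2.66), (2.70)–(2.71a); M. Salmhofer, Springer 1999, §4.3.
-/

noncomputable section

namespace Summit.HubbardSuperconductivity.HubbardSuperconductivity.Theorems.TorusFourierL2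

set_option linter.dupNamespace false -- summit = problem name (single-conjunct summit), D-0017

open Finset Complex Literature.Probability.LatticeModels Literature.MathematicalPhysics.QuantumLattice
open Literature.MathematicalPhysics.QuantumLattice.FermiRG
open Summit.HubbardSuperconductivity.HubbardSuperconductivity.Theorems.KLRegimeSplit
open Summit.HubbardSuperconductivity.HubbardSuperconductivity.Theorems.KLProgrammeLegKernels
open Summit.HubbardSuperconductivity.HubbardSuperconductivity.Theorems.EngineV8
open Summit.HubbardSuperconductivity.HubbardSuperconductivity.Theorems.PerturbedFermiCurve
open scoped Real
open Classical

variable {L M : ℕ} [NeZero L] [NeZero M]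

/-! ## §1 The thin × fat difference character sum from the thin × thin ones -/

/-- **The thin × fat DIFFERENCE character sum is at most three thin × thin difference character sums**: the fat multiplier of scale `n₂` is
the sum of the `≤ 3` neighbouring thin ones at EITHER frame (same index set), so the difference of the thin × fat products at the frames
`K′, K` is the sum over the neighbours of the thin × thin differences. [cite: BenfattoGiulianiMastropietro2006, §2.7 (2.66), (2.71a)] -/
theorem charSum_klAniso_bgmFat_sub_le {e₀ : ℝ} (he : 0 < e₀) (β μ : ℝ) (K K' : TrigPolyC4v) {n₁ n₂ : ℕ} (hn : n₂ + 1 ≤ n₁)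
    (ω₁ : Fin (sectorCount n₁)) (ω₂ : Fin (sectorCount n₂)) {T : ℝ} (hT0 : 0 ≤ T)
    (hT : ∀ a : Fin (sectorCount n₂), ∑ z : TorusSite 1 (2 * M) × TorusSite 2 L,
      ‖∑ q : TorusSite 1 (2 * M) × TorusSite 2 L, (torusChar q.1 z.1 * torusChar q.2 z.2) •
        (klAnisoFamily L M β μ K' e₀ n₁ ω₁ (⟨(q.1 0).val, ZMod.val_lt (q.1 0)⟩, q.2) *
            klAnisoFamily L M β μ K' e₀ n₂ a (⟨(q.1 0).val, ZMod.val_lt (q.1 0)⟩, q.2) -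
          klAnisoFamily L M β μ K e₀ n₁ ω₁ (⟨(q.1 0).val, ZMod.val_lt (q.1 0)⟩, q.2) *
            klAnisoFamily L M β μ K e₀ n₂ a (⟨(q.1 0).val, ZMod.val_lt (q.1 0)⟩, q.2))‖ ≤ T) :
    ∑ z : TorusSite 1 (2 * M) × TorusSite 2 L,
      ‖∑ q : TorusSite 1 (2 * M) × TorusSite 2 L, (torusChar q.1 z.1 * torusChar q.2 z.2) •
        (klAnisoFamily L M β μ K' e₀ n₁ ω₁ (⟨(q.1 0).val, ZMod.val_lt (q.1 0)⟩, q.2) *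
            bgmFatMultiplier L M e₀ β (nambuXiCT L μ K') n₂ ω₂ (⟨(q.1 0).val, ZMod.val_lt (q.1 0)⟩, q.2) -
          klAnisoFamily L M β μ K e₀ n₁ ω₁ (⟨(q.1 0).val, ZMod.val_lt (q.1 0)⟩, q.2) *
            bgmFatMultiplier L M e₀ β (nambuXiCT L μ K) n₂ ω₂ (⟨(q.1 0).val, ZMod.val_lt (q.1 0)⟩, q.2))‖ ≤ 3 * T := by
  set S := (univ : Finset (Fin (sectorCount n₂))).filter (fun a : Fin (sectorCount n₂) =>
      ∃ δ : ℤ, |δ| ≤ 1 ∧ (sectorCount n₂ : ℤ) ∣ (((a : ℕ) : ℤ) - ((ω₂ : ℕ) : ℤ) - δ)) with hS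
  have hScard : S.card ≤ 3 := card_fatNbrFin_le_three n₂ (ω₂ : ℕ)
  simp_rw [klAnisoFamily_mul_bgmFatMultiplier_eq_sum he β μ K' hn ω₁ ω₂, klAnisoFamily_mul_bgmFatMultiplier_eq_sum he β μ K hn ω₁ ω₂,
    ← Finset.sum_sub_distrib]
  refine (sum_norm_charSum_sum_le S (fun a q => klAnisoFamily L M β μ K' e₀ n₁ ω₁ (⟨(q.1 0).val, ZMod.val_lt (q.1 0)⟩, q.2) *
      klAnisoFamily L M β μ K' e₀ n₂ a (⟨(q.1 0).val, ZMod.val_lt (q.1 0)⟩, q.2) -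
    klAnisoFamily L M β μ K e₀ n₁ ω₁ (⟨(q.1 0).val, ZMod.val_lt (q.1 0)⟩, q.2) *
      klAnisoFamily L M β μ K e₀ n₂ a (⟨(q.1 0).val, ZMod.val_lt (q.1 0)⟩, q.2))).trans ?_
  calc _ ≤ ∑ _a ∈ S, T := Finset.sum_le_sum fun a _ => hT a
    _ = S.card * T := by rw [Finset.sum_const, nsmul_eq_mul]
    _ ≤ 3 * T := mul_le_mul_of_nonneg_right (by exact_mod_cast hScard) hT0

/-! ## §2 Per sector pair: position row and column sums of the defect -/

section Defect

variable {e₀ β μ : ℝ} (he : 0 < e₀) (hβ : 0 < β) (K K' : TrigPolyC4v) {n₁ n₂ : ℕ} (hn : n₂ + 1 ≤ n₁) {T : ℝ} (hT0 : 0 ≤ T)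
  (hT : ∀ (ω₁ : Fin (sectorCount n₁)) (a : Fin (sectorCount n₂)), ∑ z : TorusSite 1 (2 * M) × TorusSite 2 L,
    ‖∑ q : TorusSite 1 (2 * M) × TorusSite 2 L, (torusChar q.1 z.1 * torusChar q.2 z.2) •
      (klAnisoFamily L M β μ K' e₀ n₁ ω₁ (⟨(q.1 0).val, ZMod.val_lt (q.1 0)⟩, q.2) *
          klAnisoFamily L M β μ K' e₀ n₂ a (⟨(q.1 0).val, ZMod.val_lt (q.1 0)⟩, q.2) -
        klAnisoFamily L M β μ K e₀ n₁ ω₁ (⟨(q.1 0).val, ZMod.val_lt (q.1 0)⟩, q.2) *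
          klAnisoFamily L M β μ K e₀ n₂ a (⟨(q.1 0).val, ZMod.val_lt (q.1 0)⟩, q.2))‖ ≤ T)
include he hβ hn hT0 hT

/-- **Position ROW sums of the re-sectorisation defect, per sector pair**: `Σ_x ‖Δ((y,ω′σc),(x,ωσc))‖ ≤ 3T/(βL²)`.
[cite: BenfattoGiulianiMastropietro2006, §2.7 (2.71a)] -/
theorem rowSum_overlapDefect_le (ω' : Fin (sectorCount n₁)) (ω : Fin (sectorCount n₂)) (σ c : Fin 2) (y : SpaceTimeIdx L M) :
    ∑ x : SpaceTimeIdx L M, ‖(sectorAnalysisMatrix L M β (klAnisoFamily L M β μ K' e₀ n₁) *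
        sectorSubMatrix L M β (bgmFatMultiplier L M e₀ β (nambuXiCT L μ K') n₂) -
      sectorAnalysisMatrix L M β (klAnisoFamily L M β μ K e₀ n₁) *
        sectorSubMatrix L M β (bgmFatMultiplier L M e₀ β (nambuXiCT L μ K) n₂)) (y, ((ω', σ), c)) (x, ((ω, σ), c))‖ ≤
      1 / (β * (L : ℝ) ^ 2) * (3 * T) := by
  have hL : (0 : ℝ) < L := Nat.cast_pos.2 (Nat.pos_of_ne_zero (NeZero.ne L))
  rw [rowSum_overlapKernel_sub_eq hβ]
  exact mul_le_mul_of_nonneg_left (charSum_klAniso_bgmFat_sub_le he β μ K K' hn ω' ω hT0 (hT ω')) (by positivity)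

/-- **Position COLUMN sums of the re-sectorisation defect, per sector pair**: `Σ_y ‖Δ((y,ω′σc),(x,ωσc))‖ ≤ 3T/(βL²)`.
[cite: BenfattoGiulianiMastropietro2006, §2.7 (2.71a)] -/
theorem colSum_overlapDefect_le (ω' : Fin (sectorCount n₁)) (ω : Fin (sectorCount n₂)) (σ c : Fin 2) (x : SpaceTimeIdx L M) :
    ∑ y : SpaceTimeIdx L M, ‖(sectorAnalysisMatrix L M β (klAnisoFamily L M β μ K' e₀ n₁) *
        sectorSubMatrix L M β (bgmFatMultiplier L M e₀ β (nambuXiCT L μ K') n₂) -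
      sectorAnalysisMatrix L M β (klAnisoFamily L M β μ K e₀ n₁) *
        sectorSubMatrix L M β (bgmFatMultiplier L M e₀ β (nambuXiCT L μ K) n₂)) (y, ((ω', σ), c)) (x, ((ω, σ), c))‖ ≤
      1 / (β * (L : ℝ) ^ 2) * (3 * T) := by
  have hL : (0 : ℝ) < L := Nat.cast_pos.2 (Nat.pos_of_ne_zero (NeZero.ne L))
  rw [colSum_overlapKernel_sub_eq hβ]
  exact mul_le_mul_of_nonneg_left (charSum_klAniso_bgmFat_sub_le he β μ K K' hn ω' ω hT0 (hT ω')) (by positivity)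

/-! ## §3 The full row and column sums (all labels): the `δ` inputs -/

/-- **FULL ROW SUMS of the re-sectorisation defect** (sum over all out-labels `Y = (x, (ω, σ, c))`): `≤ (27 + 27)·(3T/(βL²))` — the joint
adjacency of the thin × fat pairs at the two frames is counted by `card_jointOverlap_le` from p4's `card_overlap_klAniso_bgmFat_coarse_le`
at each frame.  This is the pin-row input `δ` of `TwoVolumeDefect.sum_pinned_norm_kernel_map_sub_map_le` (up to the route's scalar `ε`).
[cite: BenfattoGiulianiMastropietro2006, §2.7 (2.71a)] -/
theorem fullRowSum_overlapDefect_le (Y' : SpaceTimeIdx L M × SectorLeg (sectorCount n₁)) :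
    ∑ Y : SpaceTimeIdx L M × SectorLeg (sectorCount n₂), ‖(sectorAnalysisMatrix L M β (klAnisoFamily L M β μ K' e₀ n₁) *
        sectorSubMatrix L M β (bgmFatMultiplier L M e₀ β (nambuXiCT L μ K') n₂) -
      sectorAnalysisMatrix L M β (klAnisoFamily L M β μ K e₀ n₁) *
        sectorSubMatrix L M β (bgmFatMultiplier L M e₀ β (nambuXiCT L μ K) n₂)) Y' Y‖ ≤
      ((27 + 27 : ℕ) : ℝ) * (1 / (β * (L : ℝ) ^ 2) * (3 * T)) := by
  have hL : (0 : ℝ) < L := Nat.cast_pos.2 (Nat.pos_of_ne_zero (NeZero.ne L))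
  have hovl : ∀ ω' : Fin (sectorCount n₁), ((Finset.univ : Finset (Fin (sectorCount n₂))).filter
      (fun ω => (∃ k, klAnisoFamily L M β μ K' e₀ n₁ ω' k ≠ 0 ∧ bgmFatMultiplier L M e₀ β (nambuXiCT L μ K') n₂ ω k ≠ 0) ∨
        (∃ k, klAnisoFamily L M β μ K e₀ n₁ ω' k ≠ 0 ∧ bgmFatMultiplier L M e₀ β (nambuXiCT L μ K) n₂ ω k ≠ 0))).card ≤ 27 + 27 :=
    fun ω' => card_jointOverlap_le _ _ _ _ ω' (card_overlap_klAniso_bgmFat_coarse_le he β μ K' (by omega) ω')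
      (card_overlap_klAniso_bgmFat_coarse_le he β μ K (by omega) ω')
  have h := rowSum_wt_overlapKernel_sub_le β (klAnisoFamily L M β μ K' e₀ n₁) (klAnisoFamily L M β μ K e₀ n₁)
    (bgmFatMultiplier L M e₀ β (nambuXiCT L μ K') n₂) (bgmFatMultiplier L M e₀ β (nambuXiCT L μ K) n₂) hovl (fun _ _ => (1 : ℝ))
    (B := 1 / (β * (L : ℝ) ^ 2) * (3 * T)) (by positivity)
    (fun ω' ω σ c y => by simpa only [mul_one] using rowSum_overlapDefect_le he hβ K K' hn hT0 hT ω' ω σ c y) Y'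
  simpa only [mul_one] using h

/-- **FULL COLUMN SUMS of the re-sectorisation defect** (sum over all in-labels `Y′ = (y, (ω′, σ, c))`): `≤ (27·2^{n₁−n₂} + 27·2^{n₁−n₂})·(3T/(βL²))`
(`card_jointOverlap_le'` with p4's `card_overlap_klAniso_bgmFat_fine_le` at each frame) — the column-sum input `δ`.
[cite: BenfattoGiulianiMastropietro2006, §2.7 (2.71a)] -/
theorem fullColSum_overlapDefect_le (Y : SpaceTimeIdx L M × SectorLeg (sectorCount n₂)) :
    ∑ Y' : SpaceTimeIdx L M × SectorLeg (sectorCount n₁), ‖(sectorAnalysisMatrix L M β (klAnisoFamily L M β μ K' e₀ n₁) *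
        sectorSubMatrix L M β (bgmFatMultiplier L M e₀ β (nambuXiCT L μ K') n₂) -
      sectorAnalysisMatrix L M β (klAnisoFamily L M β μ K e₀ n₁) *
        sectorSubMatrix L M β (bgmFatMultiplier L M e₀ β (nambuXiCT L μ K) n₂)) Y' Y‖ ≤
      ((27 * 2 ^ (n₁ - n₂) + 27 * 2 ^ (n₁ - n₂) : ℕ) : ℝ) * (1 / (β * (L : ℝ) ^ 2) * (3 * T)) := by
  have hL : (0 : ℝ) < L := Nat.cast_pos.2 (Nat.pos_of_ne_zero (NeZero.ne L))
  have hovl : ∀ ω : Fin (sectorCount n₂), ((Finset.univ : Finset (Fin (sectorCount n₁))).filter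
      (fun ω' => (∃ k, klAnisoFamily L M β μ K' e₀ n₁ ω' k ≠ 0 ∧ bgmFatMultiplier L M e₀ β (nambuXiCT L μ K') n₂ ω k ≠ 0) ∨
        (∃ k, klAnisoFamily L M β μ K e₀ n₁ ω' k ≠ 0 ∧ bgmFatMultiplier L M e₀ β (nambuXiCT L μ K) n₂ ω k ≠ 0))).card ≤
      27 * 2 ^ (n₁ - n₂) + 27 * 2 ^ (n₁ - n₂) :=
    fun ω => card_jointOverlap_le' _ _ _ _ ω (card_overlap_klAniso_bgmFat_fine_le he β μ K' (by omega) ω)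
      (card_overlap_klAniso_bgmFat_fine_le he β μ K (by omega) ω)
  have h := colSum_wt_overlapKernel_sub_le β (klAnisoFamily L M β μ K' e₀ n₁) (klAnisoFamily L M β μ K e₀ n₁)
    (bgmFatMultiplier L M e₀ β (nambuXiCT L μ K') n₂) (bgmFatMultiplier L M e₀ β (nambuXiCT L μ K) n₂) hovl (fun _ _ => (1 : ℝ))
    (B' := 1 / (β * (L : ℝ) ^ 2) * (3 * T)) (by positivity)
    (fun ω' ω σ c x => by simpa only [mul_one] using colSum_overlapDefect_le he hβ K K' hn hT0 hT ω' ω σ c x) Y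
  simpa only [mul_one] using h

end Defect

end Summit.HubbardSuperconductivity.HubbardSuperconductivity.Theorems.TorusFourierL2

end
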